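import Mathlib
import Summits.Ventures.PercRepro2.CutFarOA3Count

/-!
# The marks `o` and `a₃` behind an unmarked cut vertex, IV: the two-gadget rule (blind cell
PercRepro2, p3 g3, 2026-08-25; `proofs/P3-BRIDGE.md` §11.9 (c))

From the raw sorting identity of `CutFarOA3Count.lean`: the far counts are orbit-invariant
(`far_swap12/13/23`), the `w`-patterns add up to `D = #{o ∈ C_w(c), a₃ ∉ C_w(c)}` and
`E = #{o, a₃ ∈ C_w(c)}` (`far_sums`), and the root-side orbit sums are `O₁ = 2·Pa`, `O₂ = Pa`,
`O₂′ = 2·Pb`, `O₃′ = Pb` (`orbit_counts`, from the orbit identities of `CutFarOA3States.lean` through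
`six_mul_typedCount`).  **`typedCount F z τ K₃ = (Pa · D + Pb · E) · (inert)`**
(`typedCount_eq_cutFarOA3`) — row 2′TRI on the class from the two gadget instances
(`typedCount_nonneg_of_cutFarOA3`).  Own work; standard axioms.
-/

namespace Summit.Ventures.PercRepro2

open UnionCluster

namespace CovForm

namespace RootBridge

open OneTyped TypedA3 Untouched TypedFactor Separated

section Rule

open Classical

variable {V : Type*} {E : Type*} [Fintype E] [DecidableEq E] {R : Type*} [Field R]
  [LinearOrder R] [IsStrictOrderedRing R]
variable (ends : E → Sym2 V) (o a₁ a₂ a₃ b c : V)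

/-- The root count of a pattern, abbreviated. -/
noncomputable def cH (VH : Set V) (B : Finset E) (z : Config E) (τ : E → ℕ) (ox oy ow sx sy sw : Bool) : R :=
  typedCount B z τ (hKOA ends a₁ a₂ b c VH ox oy ow sx sy sw)

/-- The gadget `Pa` = the root-side sum over the orbit `O₀` (`o` pendant at `c` by a type-1 edge). -/
noncomputable def Pa (VH : Set V) (B : Finset E) (z : Config E) (τ : E → ℕ) : R :=
  cH ends a₁ a₂ b c VH B z τ true false false false false false +
    cH ends a₁ a₂ b c VH B z τ false true false false false false +
    cH ends a₁ a₂ b c VH B z τ false false true false false false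

/-- The gadget `Pb` = the root-side sum over the orbit `O₁′` (`o` and `a₃` together in one copy). -/
noncomputable def Pb (VH : Set V) (B : Finset E) (z : Config E) (τ : E → ℕ) : R :=
  cH ends a₁ a₂ b c VH B z τ true false false true false false +
    cH ends a₁ a₂ b c VH B z τ false true false false true false +
    cH ends a₁ a₂ b c VH B z τ false false true false false true


omit [LinearOrder R] [IsStrictOrderedRing R] in
/-- Six times the root-side sum over the orbit `orb0` is the count of its orbit kernel. -/
lemma six_orb0 (VH : Set V) (B : Finset E) (z : Config E) (τ : E → ℕ)
    (hτ : ∀ e ∈ B, τ e = 1 ∨ τ e = 2) :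
    (6 : R) * (cH ends a₁ a₂ b c VH B z τ true false false false false false +
        cH ends a₁ a₂ b c VH B z τ false true false false false false +
        cH ends a₁ a₂ b c VH B z τ false false true false false false) =
      typedCount B z τ (fun x y w => ((orb0 (rOA ends a₁ a₂ b c VH x) (rOA ends a₁ a₂ b c VH y)
        (rOA ends a₁ a₂ b c VH w) : ℤ) : R)) := by
  have h0 := six_mul_typedCount B z τ hτ (hKOA ends a₁ a₂ b c VH true false false false false false : Config E → Config E → Config E → R)
  have h1 := six_mul_typedCount B z τ hτ (hKOA ends a₁ a₂ b c VH false true false false false false : Config E → Config E → Config E → R)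
  have h2 := six_mul_typedCount B z τ hτ (hKOA ends a₁ a₂ b c VH false false true false false false : Config E → Config E → Config E → R)
  unfold cH
  rw [mul_add, mul_add, h0, h1, h2, ← typedCount_add', ← typedCount_add']
  refine typedCount_congr' _ _ _ _ _ fun x y w => ?_
  unfold hKOA orb0 symOB
  push_cast
  ring

omit [LinearOrder R] [IsStrictOrderedRing R] in
/-- Six times the root-side sum over the orbit `orb1` is the count of its orbit kernel. -/
lemma six_orb1 (VH : Set V) (B : Finset E) (z : Config E) (τ : E → ℕ)
    (hτ : ∀ e ∈ B, τ e = 1 ∨ τ e = 2) :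
    (6 : R) * (cH ends a₁ a₂ b c VH B z τ true false false false true false +
        cH ends a₁ a₂ b c VH B z τ true false false false false true +
        cH ends a₁ a₂ b c VH B z τ false true false true false false +
        cH ends a₁ a₂ b c VH B z τ false true false false false true +
        cH ends a₁ a₂ b c VH B z τ false false true true false false +
        cH ends a₁ a₂ b c VH B z τ false false true false true false) =
      typedCount B z τ (fun x y w => ((orb1 (rOA ends a₁ a₂ b c VH x) (rOA ends a₁ a₂ b c VH y)
        (rOA ends a₁ a₂ b c VH w) : ℤ) : R)) := by
  have h0 := six_mul_typedCount B z τ hτ (hKOA ends a₁ a₂ b c VH true false false false true false : Config E → Config E → Config E → R)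
  have h1 := six_mul_typedCount B z τ hτ (hKOA ends a₁ a₂ b c VH true false false false false true : Config E → Config E → Config E → R)
  have h2 := six_mul_typedCount B z τ hτ (hKOA ends a₁ a₂ b c VH false true false true false false : Config E → Config E → Config E → R)
  have h3 := six_mul_typedCount B z τ hτ (hKOA ends a₁ a₂ b c VH false true false false false true : Config E → Config E → Config E → R)
  have h4 := six_mul_typedCount B z τ hτ (hKOA ends a₁ a₂ b c VH false false true true false false : Config E → Config E → Config E → R)
  have h5 := six_mul_typedCount B z τ hτ (hKOA ends a₁ a₂ b c VH false false true false true false : Config E → Config E → Config E → R)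
  unfold cH
  rw [mul_add, mul_add, mul_add, mul_add, mul_add, h0, h1, h2, h3, h4, h5, ← typedCount_add', ← typedCount_add', ← typedCount_add', ← typedCount_add', ← typedCount_add']
  refine typedCount_congr' _ _ _ _ _ fun x y w => ?_
  unfold hKOA orb1 symOB
  push_cast
  ring

omit [LinearOrder R] [IsStrictOrderedRing R] in
/-- Six times the root-side sum over the orbit `orb2` is the count of its orbit kernel. -/
lemma six_orb2 (VH : Set V) (B : Finset E) (z : Config E) (τ : E → ℕ)
    (hτ : ∀ e ∈ B, τ e = 1 ∨ τ e = 2) :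
    (6 : R) * (cH ends a₁ a₂ b c VH B z τ true false false false true true +
        cH ends a₁ a₂ b c VH B z τ false true false true false true +
        cH ends a₁ a₂ b c VH B z τ false false true true true false) =
      typedCount B z τ (fun x y w => ((orb2 (rOA ends a₁ a₂ b c VH x) (rOA ends a₁ a₂ b c VH y)
        (rOA ends a₁ a₂ b c VH w) : ℤ) : R)) := by
  have h0 := six_mul_typedCount B z τ hτ (hKOA ends a₁ a₂ b c VH true false false false true true : Config E → Config E → Config E → R)
  have h1 := six_mul_typedCount B z τ hτ (hKOA ends a₁ a₂ b c VH false true false true false true : Config E → Config E → Config E → R)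
  have h2 := six_mul_typedCount B z τ hτ (hKOA ends a₁ a₂ b c VH false false true true true false : Config E → Config E → Config E → R)
  unfold cH
  rw [mul_add, mul_add, h0, h1, h2, ← typedCount_add', ← typedCount_add']
  refine typedCount_congr' _ _ _ _ _ fun x y w => ?_
  unfold hKOA orb2 symOB
  push_cast
  ring

omit [LinearOrder R] [IsStrictOrderedRing R] in
/-- Six times the root-side sum over the orbit `orb1'` is the count of its orbit kernel. -/
lemma six_orb1p (VH : Set V) (B : Finset E) (z : Config E) (τ : E → ℕ)
    (hτ : ∀ e ∈ B, τ e = 1 ∨ τ e = 2) :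
    (6 : R) * (cH ends a₁ a₂ b c VH B z τ true false false true false false +
        cH ends a₁ a₂ b c VH B z τ false true false false true false +
        cH ends a₁ a₂ b c VH B z τ false false true false false true) =
      typedCount B z τ (fun x y w => ((orb1' (rOA ends a₁ a₂ b c VH x) (rOA ends a₁ a₂ b c VH y)
        (rOA ends a₁ a₂ b c VH w) : ℤ) : R)) := by
  have h0 := six_mul_typedCount B z τ hτ (hKOA ends a₁ a₂ b c VH true false false true false false : Config E → Config E → Config E → R)
  have h1 := six_mul_typedCount B z τ hτ (hKOA ends a₁ a₂ b c VH false true false false true false : Config E → Config E → Config E → R)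
  have h2 := six_mul_typedCount B z τ hτ (hKOA ends a₁ a₂ b c VH false false true false false true : Config E → Config E → Config E → R)
  unfold cH
  rw [mul_add, mul_add, h0, h1, h2, ← typedCount_add', ← typedCount_add']
  refine typedCount_congr' _ _ _ _ _ fun x y w => ?_
  unfold hKOA orb1' symOB
  push_cast
  ring

omit [LinearOrder R] [IsStrictOrderedRing R] in
/-- Six times the root-side sum over the orbit `orb2'` is the count of its orbit kernel. -/
lemma six_orb2p (VH : Set V) (B : Finset E) (z : Config E) (τ : E → ℕ)
    (hτ : ∀ e ∈ B, τ e = 1 ∨ τ e = 2) :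
    (6 : R) * (cH ends a₁ a₂ b c VH B z τ true false false true true false +
        cH ends a₁ a₂ b c VH B z τ true false false true false true +
        cH ends a₁ a₂ b c VH B z τ false true false true true false +
        cH ends a₁ a₂ b c VH B z τ false true false false true true +
        cH ends a₁ a₂ b c VH B z τ false false true true false true +
        cH ends a₁ a₂ b c VH B z τ false false true false true true) =
      typedCount B z τ (fun x y w => ((orb2' (rOA ends a₁ a₂ b c VH x) (rOA ends a₁ a₂ b c VH y)
        (rOA ends a₁ a₂ b c VH w) : ℤ) : R)) := by
  have h0 := six_mul_typedCount B z τ hτ (hKOA ends a₁ a₂ b c VH true false false true true false : Config E → Config E → Config E → R)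
  have h1 := six_mul_typedCount B z τ hτ (hKOA ends a₁ a₂ b c VH true false false true false true : Config E → Config E → Config E → R)
  have h2 := six_mul_typedCount B z τ hτ (hKOA ends a₁ a₂ b c VH false true false true true false : Config E → Config E → Config E → R)
  have h3 := six_mul_typedCount B z τ hτ (hKOA ends a₁ a₂ b c VH false true false false true true : Config E → Config E → Config E → R)
  have h4 := six_mul_typedCount B z τ hτ (hKOA ends a₁ a₂ b c VH false false true true false true : Config E → Config E → Config E → R)
  have h5 := six_mul_typedCount B z τ hτ (hKOA ends a₁ a₂ b c VH false false true false true true : Config E → Config E → Config E → R)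
  unfold cH
  rw [mul_add, mul_add, mul_add, mul_add, mul_add, h0, h1, h2, h3, h4, h5, ← typedCount_add', ← typedCount_add', ← typedCount_add', ← typedCount_add', ← typedCount_add']
  refine typedCount_congr' _ _ _ _ _ fun x y w => ?_
  unfold hKOA orb2' symOB
  push_cast
  ring

omit [LinearOrder R] [IsStrictOrderedRing R] in
/-- Six times the root-side sum over the orbit `orb3'` is the count of its orbit kernel. -/
lemma six_orb3p (VH : Set V) (B : Finset E) (z : Config E) (τ : E → ℕ)
    (hτ : ∀ e ∈ B, τ e = 1 ∨ τ e = 2) :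
    (6 : R) * (cH ends a₁ a₂ b c VH B z τ true false false true true true +
        cH ends a₁ a₂ b c VH B z τ false true false true true true +
        cH ends a₁ a₂ b c VH B z τ false false true true true true) =
      typedCount B z τ (fun x y w => ((orb3' (rOA ends a₁ a₂ b c VH x) (rOA ends a₁ a₂ b c VH y)
        (rOA ends a₁ a₂ b c VH w) : ℤ) : R)) := by
  have h0 := six_mul_typedCount B z τ hτ (hKOA ends a₁ a₂ b c VH true false false true true true : Config E → Config E → Config E → R)
  have h1 := six_mul_typedCount B z τ hτ (hKOA ends a₁ a₂ b c VH false true false true true true : Config E → Config E → Config E → R)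
  have h2 := six_mul_typedCount B z τ hτ (hKOA ends a₁ a₂ b c VH false false true true true true : Config E → Config E → Config E → R)
  unfold cH
  rw [mul_add, mul_add, h0, h1, h2, ← typedCount_add', ← typedCount_add']
  refine typedCount_congr' _ _ _ _ _ fun x y w => ?_
  unfold hKOA orb3' symOB
  push_cast
  ring

omit [LinearOrder R] [IsStrictOrderedRing R] in
/-- Doubling a kernel doubles the count. -/
lemma typedCount_two_mul (B : Finset E) (z : Config E) (τ : E → ℕ)
    (K : Config E → Config E → Config E → R) :
    typedCount B z τ (fun x y w => 2 * K x y w) = 2 * typedCount B z τ K := by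
  have : (fun x y w => 2 * K x y w) = fun x y w => K x y w + K x y w := by
    funext x y w; ring
  rw [this, typedCount_add']; ring

/-- **The orbit counts**: `O₁ = 2·Pa`, `O₂ = Pa`, `O₂′ = 2·Pb`, `O₃′ = Pb` (the orbit identities of
`CutFarOA3States.lean` on the valid root bits, through the six-fold symmetrisation). -/
theorem orbit_counts (VH : Set V) (B : Finset E) (z : Config E) (τ : E → ℕ)
    (hτ : ∀ e ∈ B, τ e = 1 ∨ τ e = 2) :
    (cH (R := R) ends a₁ a₂ b c VH B z τ true false false false true false +
        cH (R := R) ends a₁ a₂ b c VH B z τ true false false false false true +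
        cH (R := R) ends a₁ a₂ b c VH B z τ false true false true false false +
        cH (R := R) ends a₁ a₂ b c VH B z τ false true false false false true +
        cH (R := R) ends a₁ a₂ b c VH B z τ false false true true false false +
        cH (R := R) ends a₁ a₂ b c VH B z τ false false true false true false = 2 * Pa (R := R) ends a₁ a₂ b c VH B z τ) ∧
    (cH (R := R) ends a₁ a₂ b c VH B z τ true false false false true true +
        cH (R := R) ends a₁ a₂ b c VH B z τ false true false true false true +
        cH (R := R) ends a₁ a₂ b c VH B z τ false false true true true false = Pa (R := R) ends a₁ a₂ b c VH B z τ) ∧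
    (cH (R := R) ends a₁ a₂ b c VH B z τ true false false true true false +
        cH (R := R) ends a₁ a₂ b c VH B z τ true false false true false true +
        cH (R := R) ends a₁ a₂ b c VH B z τ false true false true true false +
        cH (R := R) ends a₁ a₂ b c VH B z τ false true false false true true +
        cH (R := R) ends a₁ a₂ b c VH B z τ false false true true false true +
        cH (R := R) ends a₁ a₂ b c VH B z τ false false true false true true = 2 * Pb (R := R) ends a₁ a₂ b c VH B z τ) ∧
    (cH (R := R) ends a₁ a₂ b c VH B z τ true false false true true true +
        cH (R := R) ends a₁ a₂ b c VH B z τ false true false true true true +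
        cH (R := R) ends a₁ a₂ b c VH B z τ false false true true true true = Pb (R := R) ends a₁ a₂ b c VH B z τ) := by
  have hv := fun x => rOA_valid ends a₁ a₂ b c VH x
  have s0 := six_orb0 (R := R) ends a₁ a₂ b c VH B z τ hτ
  have s1 := six_orb1 (R := R) ends a₁ a₂ b c VH B z τ hτ
  have s2 := six_orb2 (R := R) ends a₁ a₂ b c VH B z τ hτ
  have s1p := six_orb1p (R := R) ends a₁ a₂ b c VH B z τ hτ
  have s2p := six_orb2p (R := R) ends a₁ a₂ b c VH B z τ hτ
  have s3p := six_orb3p (R := R) ends a₁ a₂ b c VH B z τ hτ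
  have ea : typedCount B z τ (fun x y w => ((orb1 (rOA ends a₁ a₂ b c VH x) (rOA ends a₁ a₂ b c VH y)
      (rOA ends a₁ a₂ b c VH w) : ℤ) : R)) = 2 * typedCount B z τ (fun x y w =>
      ((orb0 (rOA ends a₁ a₂ b c VH x) (rOA ends a₁ a₂ b c VH y) (rOA ends a₁ a₂ b c VH w) : ℤ) : R)) := by
    rw [← typedCount_two_mul]
    refine typedCount_congr' _ _ _ _ _ fun x y w => ?_
    rw [orbit_a _ _ _ (hv x) (hv y) (hv w)]; push_cast; ring
  have eb : typedCount B z τ (fun x y w => ((orb2 (rOA ends a₁ a₂ b c VH x) (rOA ends a₁ a₂ b c VH y)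
      (rOA ends a₁ a₂ b c VH w) : ℤ) : R)) = typedCount B z τ (fun x y w =>
      ((orb0 (rOA ends a₁ a₂ b c VH x) (rOA ends a₁ a₂ b c VH y) (rOA ends a₁ a₂ b c VH w) : ℤ) : R)) := by
    refine typedCount_congr' _ _ _ _ _ fun x y w => ?_
    rw [orbit_b _ _ _ (hv x) (hv y) (hv w)]
  have ec : typedCount B z τ (fun x y w => ((orb2' (rOA ends a₁ a₂ b c VH x) (rOA ends a₁ a₂ b c VH y)
      (rOA ends a₁ a₂ b c VH w) : ℤ) : R)) = 2 * typedCount B z τ (fun x y w =>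
      ((orb1' (rOA ends a₁ a₂ b c VH x) (rOA ends a₁ a₂ b c VH y) (rOA ends a₁ a₂ b c VH w) : ℤ) : R)) := by
    rw [← typedCount_two_mul]
    refine typedCount_congr' _ _ _ _ _ fun x y w => ?_
    rw [orbit_c _ _ _ (hv x) (hv y) (hv w)]; push_cast; ring
  have ed : typedCount B z τ (fun x y w => ((orb3' (rOA ends a₁ a₂ b c VH x) (rOA ends a₁ a₂ b c VH y)
      (rOA ends a₁ a₂ b c VH w) : ℤ) : R)) = typedCount B z τ (fun x y w =>
      ((orb1' (rOA ends a₁ a₂ b c VH x) (rOA ends a₁ a₂ b c VH y) (rOA ends a₁ a₂ b c VH w) : ℤ) : R)) := by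
    refine typedCount_congr' _ _ _ _ _ fun x y w => ?_
    rw [orbit_d _ _ _ (hv x) (hv y) (hv w)]
  unfold Pa Pb
  refine ⟨?_, ?_, ?_, ?_⟩
  · have : (6 : R) ≠ 0 := by norm_num
    apply mul_left_cancel₀ this
    rw [s1, ea, ← mul_assoc, mul_comm (6 : R) 2, mul_assoc, s0]
  · have : (6 : R) ≠ 0 := by norm_num
    apply mul_left_cancel₀ this
    rw [s2, eb, s0]
  · have : (6 : R) ≠ 0 := by norm_num
    apply mul_left_cancel₀ this
    rw [s2p, ec, ← mul_assoc, mul_comm (6 : R) 2, mul_assoc, s1p]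
  · have : (6 : R) ≠ 0 := by norm_num
    apply mul_left_cancel₀ this
    rw [s3p, ed, s1p]

/-- **THE TWO-GADGET RULE** for `o, a₃` behind an unmarked cut vertex:
`typedCount F z τ K₃ = (Pa · D + Pb · E) · (inert count)`. -/
theorem typedCount_eq_cutFarOA3 {VL VH : Set V} (F : Finset E) (z : Config E) (τ : E → ℕ)
    (hτ : ∀ e ∈ F, τ e = 1 ∨ τ e = 2) (h : CutFarOA3 ends o a₁ a₂ a₃ b c VL VH F z) :
    typedCount F z τ (K3 ends o a₁ a₂ a₃ b : Config E → Config E → Config E → R) =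
      (Pa (R := R) ends a₁ a₂ b c VH (sideF ends VH F) z τ * farD (R := R) ends o a₃ c VL (sideF ends VL F) z τ +
        Pb (R := R) ends a₁ a₂ b c VH (sideF ends VH F) z τ * farE (R := R) ends o a₃ c VL (sideF ends VL F) z τ) *
        typedCount (F \ (sideF ends VL F ∪ sideF ends VH F)) z τ (fun _ _ _ => (1 : R)) := by
  have hτA : ∀ e ∈ sideF ends VL F, τ e = 1 ∨ τ e = 2 :=
    fun e he => hτ e (Finset.filter_subset _ _ he)
  have hτB : ∀ e ∈ sideF ends VH F, τ e = 1 ∨ τ e = 2 :=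
    fun e he => hτ e (Finset.filter_subset _ _ he)
  rw [typedCount_eq_cutFarOA3_raw ends o a₁ a₂ a₃ b c F z τ h]
  rw [far_swap13 (R := R) ends o a₃ c VL (sideF ends VL F) z τ hτA true false false false false false,
    far_swap13 (R := R) ends o a₃ c VL (sideF ends VL F) z τ hτA true false false true false false,
    far_swap13 (R := R) ends o a₃ c VL (sideF ends VL F) z τ hτA true false false false true false,
    far_swap13 (R := R) ends o a₃ c VL (sideF ends VL F) z τ hτA true false false false false true,
    far_swap13 (R := R) ends o a₃ c VL (sideF ends VL F) z τ hτA true false false true true false,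
    far_swap13 (R := R) ends o a₃ c VL (sideF ends VL F) z τ hτA true false false true false true,
    far_swap13 (R := R) ends o a₃ c VL (sideF ends VL F) z τ hτA true false false false true true,
    far_swap13 (R := R) ends o a₃ c VL (sideF ends VL F) z τ hτA true false false true true true]
  rw [far_swap23 (R := R) ends o a₃ c VL (sideF ends VL F) z τ hτA false true false false false false,
    far_swap23 (R := R) ends o a₃ c VL (sideF ends VL F) z τ hτA false true false true false false,
    far_swap23 (R := R) ends o a₃ c VL (sideF ends VL F) z τ hτA false true false false true false,
    far_swap23 (R := R) ends o a₃ c VL (sideF ends VL F) z τ hτA false true false false false true,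
    far_swap23 (R := R) ends o a₃ c VL (sideF ends VL F) z τ hτA false true false true true false,
    far_swap23 (R := R) ends o a₃ c VL (sideF ends VL F) z τ hτA false true false true false true,
    far_swap23 (R := R) ends o a₃ c VL (sideF ends VL F) z τ hτA false true false false true true,
    far_swap23 (R := R) ends o a₃ c VL (sideF ends VL F) z τ hτA false true false true true true]
  have e12 := far_swap12 (R := R) ends o a₃ c VL (sideF ends VL F) z τ false false true true false false
  have e12' := far_swap12 (R := R) ends o a₃ c VL (sideF ends VL F) z τ false false true true false true
  obtain ⟨hD, hE⟩ := far_sums (R := R) ends o a₃ c VL (sideF ends VL F) z τ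
  obtain ⟨ho1, ho2, ho3, ho4⟩ := orbit_counts (R := R) ends a₁ a₂ b c VH (sideF ends VH F) z τ hτB
  unfold Pa Pb at *
  unfold cH at *
  linear_combination typedCount (F \ (sideF ends VL F ∪ sideF ends VH F)) z τ (fun _ _ _ => (1 : R)) *
    (typedCount (sideF ends VL F) z τ (lKOA ends o a₃ c VL false false true false true false) * ho1 + typedCount (sideF ends VL F) z τ (lKOA ends o a₃ c VL false false true true true false) * ho2 +
      typedCount (sideF ends VL F) z τ (lKOA ends o a₃ c VL false false true false true true) * ho3 + typedCount (sideF ends VL F) z τ (lKOA ends o a₃ c VL false false true true true true) * ho4 +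
      (typedCount (sideF ends VH F) z τ (hKOA ends a₁ a₂ b c VH false false true true false false) + typedCount (sideF ends VH F) z τ (hKOA ends a₁ a₂ b c VH true false false false false true) + typedCount (sideF ends VH F) z τ (hKOA ends a₁ a₂ b c VH false true false true false false) - (typedCount (sideF ends VH F) z τ (hKOA ends a₁ a₂ b c VH true false false false false false) + typedCount (sideF ends VH F) z τ (hKOA ends a₁ a₂ b c VH false true false false false false) + typedCount (sideF ends VH F) z τ (hKOA ends a₁ a₂ b c VH false false true false false false))) * e12 +
      (typedCount (sideF ends VH F) z τ (hKOA ends a₁ a₂ b c VH false false true true false true) + typedCount (sideF ends VH F) z τ (hKOA ends a₁ a₂ b c VH true false false true false true) + typedCount (sideF ends VH F) z τ (hKOA ends a₁ a₂ b c VH false true false true true false) - (typedCount (sideF ends VH F) z τ (hKOA ends a₁ a₂ b c VH true false false true false false) + typedCount (sideF ends VH F) z τ (hKOA ends a₁ a₂ b c VH false true false false true false) + typedCount (sideF ends VH F) z τ (hKOA ends a₁ a₂ b c VH false false true false false true))) * e12' +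
      (typedCount (sideF ends VH F) z τ (hKOA ends a₁ a₂ b c VH true false false false false false) + typedCount (sideF ends VH F) z τ (hKOA ends a₁ a₂ b c VH false true false false false false) + typedCount (sideF ends VH F) z τ (hKOA ends a₁ a₂ b c VH false false true false false false)) * hD +
      (typedCount (sideF ends VH F) z τ (hKOA ends a₁ a₂ b c VH true false false true false false) + typedCount (sideF ends VH F) z τ (hKOA ends a₁ a₂ b c VH false true false false true false) + typedCount (sideF ends VH F) z τ (hKOA ends a₁ a₂ b c VH false false true false false true)) * hE)

/-- **Row 2′TRI when `o` and `a₃` sit behind an unmarked cut vertex** follows from row 2′TRI on the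
two gadget instances `Pa` (`o` pendant at `c` by a type-1 edge, `a₃` absent) and `Pb` (`o` and `a₃`
hung together on one type-1 edge at `c`). -/
theorem typedCount_nonneg_of_cutFarOA3 {VL VH : Set V} (F : Finset E) (z : Config E) (τ : E → ℕ)
    (hτ : ∀ e ∈ F, τ e = 1 ∨ τ e = 2) (h : CutFarOA3 ends o a₁ a₂ a₃ b c VL VH F z)
    (ha : 0 ≤ Pa (R := R) ends a₁ a₂ b c VH (sideF ends VH F) z τ)
    (hb : 0 ≤ Pb (R := R) ends a₁ a₂ b c VH (sideF ends VH F) z τ) :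
    0 ≤ typedCount F z τ (K3 ends o a₁ a₂ a₃ b : Config E → Config E → Config E → R) := by
  rw [typedCount_eq_cutFarOA3 ends o a₁ a₂ a₃ b c F z τ hτ h]
  have hD : (0 : R) ≤ farD (R := R) ends o a₃ c VL (sideF ends VL F) z τ := by
    unfold farD
    refine typedCount_nonneg_of_nonneg _ _ _ fun x y w => ?_
    unfold indOB
    split_ifs <;> simp
  have hE : (0 : R) ≤ farE (R := R) ends o a₃ c VL (sideF ends VL F) z τ := by
    unfold farE
    refine typedCount_nonneg_of_nonneg _ _ _ fun x y w => ?_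
    unfold indOB
    split_ifs <;> simp
  have hI : (0 : R) ≤ typedCount (F \ (sideF ends VL F ∪ sideF ends VH F)) z τ
      (fun _ _ _ => (1 : R)) :=
    typedCount_nonneg_of_nonneg _ _ _ fun _ _ _ => zero_le_one
  exact mul_nonneg (add_nonneg (mul_nonneg ha hD) (mul_nonneg hb hE)) hI


end Rule

end RootBridge

end CovForm

end Summit.Ventures.PercRepro2
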